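import Summits.QuantumFields.QCD.Theses.NestedDissectionSea
import Literature.MathematicalPhysics.QuantumFieldTheory.QuasiLocalGaugePerturbationWilson
import Summits.QuantumFields.QCD.Theorems.NestedDissectionSeaRobustYangMillsRGStubGaugeAveraging
import Summits.QuantumFields.QCD.Theorems.NestedDissectionSeaRobustYangMillsRGStubWilsonAnalyticNorm
import Summits.QuantumFields.QCD.Theorems.NestedDissectionSeaRobustYangMillsRGStubSU3SignSet
import Summits.QuantumFields.QCD.Theorems.NestedDissectionSeaRobustYangMillsRGStubFormatBallClusteringFalse
import Summits.QuantumFields.QCD.Theorems.NestedDissectionSeaRobustYangMillsRGStubPositiveTransfer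

/-!
# Birth skeleton — crux `RobustYangMillsRG` of route `NestedDissectionSea`
# (block-level rev 3 = stmt-QuantumFields-17812, shared verbatim with `HeavyThresholdYMBridge`;
# the registrar's unit item stmt-QuantumFields-18010 was restated 1:1 to this text at
# 2026-08-17T02:27:45Z, route rev 37 — same decl, same `Cruxes/RobustYangMillsRG/` directory)

Skeleton registrar `planner-skel-stmt-QuantumFields-18010-0` (planner one-shot, re-audit bin
HONEST-BET), 2026-08-17.

The crux (COERCIVE-FORMAT ROBUSTNESS OF THE GAPPED PHASE AT ONE BLOCK SCALE) says: for every
format `(ε, r, B₀, κ, c₀)`, coercivity `cA` and principal-norm bound `A₀` there is `β₀` such that,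
for all scaling data `(a, L)`, every block scale `ℓ₀`, every convergent `βe ≥ β₀`, every measurable
local covariant blocking `Bl` and every family of SIGNED, gauge/translation/reflection/permutation
invariant, reflection-positive fine-torus weights `w` whose `Bl`-pushforward has, eventually in `k`
and for all volumes `S ≥ L k`, the exact coercive-format density `exp(−βe A − W)·F(LF_ε V, V)`
(`AdmAt`), the blocked laws cluster uniformly in time slabs: ONE `Δ > 0`, and for every slab
thickness `h` a constant `C`, with `|E[G₁(V) G₂(τ_t V)] − E[G₁(V)] E[G₂(τ_t V)]| ≤ C C₁ C₂ e^{−Δ ℓ₀ t}`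
for `V = Bl U`, all bounded measurable block observables `G₁, G₂` supported in the slab `[0, h)`,
all block time shifts `t` with `2t ≤ M`.

## LEAD STATUS (prover-line-stmt-QuantumFields-17812-0, cycle 1, 2026-08-17) — read this first

The registrar's three-stub cut below is kept as history (`RobustYangMillsRG_of`, `RobustYangMillsRG_skeleton_v1`).
After two waves the skeleton is CLOSED MODULO TWO NAMED CONDITIONS, both registered stubs:
* `stub_blockedLawNonneg` — REALISABILITY ⇒ POSITIVITY: the `Bl`-pushforward of an admissible signed
  fine weight is a positive measure (`0 ≤ F (LF V) V` a.e.). Trivial under the refuter's repair C′ₐ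
  (`0 ≤ w` in `AdmAt`); for the signed RP class uncertified either way: RP + invariances do NOT give it
  (W-SSB's signed axis-line weight, evidence `StubSlabStateBound.lean`), the format alone does NOT give
  it (`formatBallClustering_false`, landed), and a certified signed admissible member (which would
  refute it AND the crux at `t = 0`) is not constructible with present tools.
* `stub_positiveInvariantFormatClustering` — THE YANG–MILLS-GRADE KERNEL, context-free: uniform slab
  clustering of gauge-invariant observables under every normalised POSITIVE coercive-format density on
  the block torus, couplings in a window above the threshold.
Everything else is a tree theorem: `stub_gaugeAveraging` (p144528, reduction to invariant observables;
toolkit p143111), `slabStateBound_of_blockedLawNonneg` (here, K = 1), `stub_positiveTransfer` (p151123,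
pushforward bookkeeping + a.e. positivity + `|F|`-repair), and the negative certificate of the
af-funnel sub-cut `stub_formatBallClustering_false` (p149100; helpers `stub_wilsonAnalyticNorm` p142801,
`stub_su3SignSet` p142658, aux p146753/p147347/p146756/p146759). Composition: `RobustYangMillsRG_of'`.
Recommendation to planners: restate the crux with `0 ≤ w k S U` (or block-level `0 ≤ F Z V`) — then
this line is exactly `PositiveInvariantFormatClustering`, a clean named condition / promotable item.

## The line (three stubs, one kernel-checked composition)

* `stub_slabStateBound` — THE SIGNED STATE IS BOUNDED ON SLABS: for every slab thickness `h` one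
  `K` with `|E[G₀ ∘ Bl]| ≤ K·sup|G₀|` for all bounded measurable block observables supported in the
  slab `[0, h)`, eventually in `k`, uniformly in `S ≥ L k`. Trivial (`K = 1`) for positive weights;
  for the SIGNED class it is the statement that the negative mass of the pushforward density —
  confined to rough regions `LF(V) ≠ ∅`, since `F(∅, ·) = 1` — is a dilute polymer correction
  (Peierls bound from the coercivity `cA·Σ_p(3 − Re tr V_p) ≤ A(V) − A(𝟙)` at `βe ≥ β₀`, with
  `|F(Z,·)| ≤ e^{c₀|Z|}` and the `e^{−κn}` locality/factorisation of `F`). Size L.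
* `stub_gaugeInvariantClustering` — THE CORE: the crux's conclusion for block-GAUGE-INVARIANT
  slab observables `G₁, G₂` (two extra hypotheses `∀ g V, Gᵢ (gaugeTransform g V) = Gᵢ V`), i.e.
  the volume-uniform mass gap of the coercive-format class in the physical (gauge-invariant)
  sector. HARDEST stub — Yang–Mills-grade (⊇ the lattice mass gap for the perfect-action class);
  every serious line on the crux is a line on this stub (RG iteration of the format while
  `βe` stays large, then an infrared input at the reference scale; or a direct expansion).
* `stub_gaugeAveraging` — REDUCTION TO THE GAUGE-INVARIANT SECTOR: in the admissible context,
  (slab state bound) → (gauge-invariant clustering) → (clustering for ALL bounded measurable slab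
  observables). Mechanism: the blocked state is invariant under block gauge transformations
  (fine gauge invariance of `w`, covariance `Bl (g̃·U) = (g̃ ∘ cor)·Bl U`, and every block gauge
  field lifts through the injective corner map `cor`); Haar-averaging `G ↦ Ḡ` preserves
  measurability, the bound, the slab support and expectations; for `t > h` the gauge supports of
  `G₁` (site times `[0, h]`) and `G₂ ∘ τ_t` (site times `[t, t + h]`, no wrap since `2t ≤ M`) are
  disjoint, so the joint Haar average FACTORISES, `E[G₁ · G₂∘τ_t] = E[Ḡ₁ · Ḡ₂∘τ_t]`, and the
  gauge-invariant bound applies verbatim; for the finitely many `t ≤ h` the slab state bound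
  (slab `2h`) gives `|trunc| ≤ (K + K²) C₁ C₂ ≤ (K + K²) e^{Δ ℓ₀ h} · C₁ C₂ e^{−Δ ℓ₀ t}`. Size M–L
  (measure theory on compact groups: Fubini for the Haar average, independence over disjoint site
  sets, the `cor`-lift).
* `RobustYangMillsRG_of` — the composition, PROVED (no `sorry`): `β₀ := max β₁ (max β₂ β₃)` and
  modus ponens inside the shared context.

Standing disprover's load-bearing analysis (`Cruxes/RobustYangMillsRG/Disproof.lean`, on rev 2):
any proof must use a property of the blocking/format forcing the fibre infimum of the principal
part to be positive — in this rev the principal functional `A` is a hypothesis-side COERCIVE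
quasi-local functional (`cA·S_W ≤ A − A(𝟙)`), and it is used in `stub_slabStateBound` (Peierls
suppression of rough regions) and in `stub_gaugeInvariantClustering` (the gapped phase); the
`β = 0` Haar witness is not admissible (it would need `βe·cA·ε ≤ 2B₀` per rough site).

Sorries: exactly three, one inside each `stub_*`; none elsewhere.

Layout (for the `#h21_check_skeleton` by-name rule): `Statement.stub_<name> : Prop` are the NAMED stub statements
(verbatim the signatures of the `theorem stub_<name>` declarations below them); `RobustYangMillsRG_of` takes the
three named statements as hypotheses and concludes the crux BY NAME with a sorry-free closure
(`[propext, Classical.choice, Quot.sound]`); `RobustYangMillsRG_skeleton` feeds it the three sorried stubs, which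
kernel-checks that the inline stub signatures and the named statements agree.
-/

namespace Summit.QuantumFields.QCD.Cruxes.RobustYangMillsRG.Birth

open scoped BigOperators Topology Manifold Classical MeasureTheory ProbabilityTheory Matrix InnerProductSpace ComplexConjugate ContinuousMap
open Filter Set Function TopologicalSpace MeasureTheory
open Literature.MathematicalPhysics.QuantumLattice Literature.MathematicalPhysics.AQFT
  Literature.MathematicalPhysics.QuantumFieldTheory


/-! ### Named stub statements (by-name hypotheses of the composition) -/

/-- Named statement of `stub_slabStateBound` (verbatim its signature). -/
def Statement.stub_slabStateBound : Prop :=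
    let G := ↥(Matrix.specialUnitaryGroup (Fin 3) ℂ); let ρ : G →* Matrix (Fin 3) (Fin 3) ℂ := fundamentalRep (Fin 3); ∀ ε r B₀ κ c₀ cA A₀ : ℝ, 0 < ε → 0 < r → 0 < B₀ → 0 < κ → 0 < c₀ → 0 < cA → 0 < A₀ → ∃ β₀ : ℝ, 0 < β₀ ∧ ∀ (a : ℕ → ℝ) (L : ℕ → ℕ), (∀ k, 0 < a k) → Tendsto a atTop (nhds 0) → Tendsto (fun k => a k * L k) atTop atTop → ∀ ℓ₀ : ℝ, 0 < ℓ₀ → let b : ℕ → ℕ := fun k => ⌊ℓ₀ / a k⌋₊; let N : ℕ → ℕ := fun S => 2 * S + 1; let M : ℕ → ℕ → ℕ := fun k S => N S / b k - 1 + 1; let cor : (k S : ℕ) → Site 4 (M k S) → Site 4 (N S) := fun k S y i => ((N S * (y i).val / M k S : ℕ) : ZMod (N S)); let μ : (n : ℕ) → [NeZero n] → Measure (GaugeConfig 4 n G) := fun _ _ => Measure.pi fun _ => haarProbability G; let LF : (k S : ℕ) → GaugeConfig 4 (M k S) G → Finset (Site 4 (M k S)) := fun _ _ V => Finset.univ.filter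 fun y => ∃ i j : Fin 4, ε < 3 - (ρ (plaquetteHolonomy V y i j)).trace.re; let AdmAt : ((k S : ℕ) → GaugeConfig 4 (N S) G → ℝ) → (ℕ → ℝ) → ((k S : ℕ) → GaugeConfig 4 (N S) G → GaugeConfig 4 (M k S) G) → ℕ → ℕ → Prop := fun w βe Bl k S => Measurable (w k S) ∧ (0 < ∫ U, w k S U ∂(μ (N S))) ∧ (∀ g U, w k S (gaugeTransform g U) = w k S U) ∧ (∀ v U, w k S (torusConfigShift v U) = w k S U) ∧ (∀ U, w k S (GaugeConfig.timeReflect U) = w k S U) ∧ (∀ (π : Equiv.Perm (Fin 4)) U, w k S (U ∘ fun e => (e.1 ∘ π, π.symm e.2)) = w k S U) ∧ (∀ F : GaugeConfig 4 (N S) G → ℝ, Measurable F → (∃ C, ∀ U, |F U| ≤ C) → IsPositiveTimeObservable F → 0 ≤ ∫ U, F U.timeReflect * F U * w k S U ∂(μ (N S))) ∧ Measurable (Bl k S) ∧ (∀ g U, Bl k S (gaugeTransform g U) = gaugeTransform (g ∘ cor k S) (Bl k S U)) ∧ (∀ e, DependsOn (fun U => Bl k S U e) {e' | ∀ i, (e'.1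 i - cor k S e.1 i).val ≤ 5 * b k ∨ (cor k S e.1 i - e'.1 i).val ≤ 5 * b k}) ∧ ∃ (A W : QuasiLocalGaugePerturbation 4 (M k S) G 1) (F : Finset (Site 4 (M k S)) → GaugeConfig 4 (M k S) G → ℝ), A.HasAnalyticNormLE ρ (smallFieldDomain ρ 1 r ε) κ A₀ ∧ A.NormLE κ A₀ ∧ (∀ X ∈ polymers 1, (∃ V, A.act X V ≠ 0) → ∀ y ∈ X, ∀ y' ∈ X, ∀ i, (y i - y' i).val ≤ X.card ∨ (y' i - y i).val ≤ X.card) ∧ (∀ V, cA * wilsonAction ρ V ≤ A.total V - A.total fun _ => 1) ∧ W.HasAnalyticNormLE ρ (smallFieldDomain ρ 1 r ε) κ B₀ ∧ W.NormLE κ B₀ ∧ (∀ X ∈ polymers 1, (∃ V, W.act X V ≠ 0) → ∀ y ∈ X, ∀ y' ∈ X, ∀ i, (y i - y' i).val ≤ X.card ∨ (y' i - y i).val ≤ X.card) ∧ (∀ Z, Measurable (F Z)) ∧ (∀ V, F ∅ V = 1) ∧ (∀ Z V, |F Z V| ≤ Real.exp (c₀ * Z.card)) ∧ (∀ Z (n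 : ℕ) V V', (∀ e, (∃ y ∈ Z, ∀ i, (e.1 i - y i).val ≤ n ∨ (y i - e.1 i).val ≤ n) → V e = V' e) → |F Z V - F Z V'| ≤ Real.exp (c₀ * Z.card + κ * (4 - n))) ∧ (∀ Z₁ Z₂ (n : ℕ), (∀ y ∈ Z₁, ∀ y' ∈ Z₂, ∃ i, n < (y i - y' i).val ∧ n < (y' i - y i).val) → ∀ V, |F (Z₁ ∪ Z₂) V - F Z₁ V * F Z₂ V| ≤ Real.exp (c₀ * (Z₁.card + Z₂.card) + κ * (4 - n))) ∧ ∀ Gf, Measurable Gf → (∃ C, ∀ V, |Gf V| ≤ C) → ∫ U, Gf (Bl k S U) * w k S U ∂(μ (N S)) = ∫ V, Gf V * (Real.exp (-(βe k * A.total V) - W.total V) * F (LF k S V) V) ∂(μ (M k S)); ∀ (w : (k S : ℕ) → GaugeConfig 4 (N S) G → ℝ) (βe : ℕ → ℝ) (Bl : (k S : ℕ) → GaugeConfig 4 (N S) G → GaugeConfig 4 (M k S) G), (∃ βl, Tendsto βe atTop (nhds βl)) → (∀ᶠ k in atTop, β₀ ≤ βe k ∧ ∀ S, L k ≤ S → AdmAt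 w βe Bl k S) → let E : (k S : ℕ) → (GaugeConfig 4 (N S) G → ℝ) → ℝ := fun k S h => (∫ U, h U * w k S U ∂(μ (N S))) / ∫ U, w k S U ∂(μ (N S)); ∀ h : ℕ, ∃ K : ℝ, ∀ᶠ k in atTop, ∀ S, L k ≤ S → ∀ (G₀ : GaugeConfig 4 (M k S) G → ℝ) (C₀ : ℝ) (s : ZMod (M k S)), Measurable G₀ → (∀ V, |G₀ V| ≤ C₀) → DependsOn G₀ {e | (e.1 0 - s).val < h} → |E k S (fun U => G₀ (Bl k S U))| ≤ K * C₀

/-- Named statement of `stub_gaugeInvariantClustering` (verbatim its signature). -/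
def Statement.stub_gaugeInvariantClustering : Prop :=
    let G := ↥(Matrix.specialUnitaryGroup (Fin 3) ℂ); let ρ : G →* Matrix (Fin 3) (Fin 3) ℂ := fundamentalRep (Fin 3); ∀ ε r B₀ κ c₀ cA A₀ : ℝ, 0 < ε → 0 < r → 0 < B₀ → 0 < κ → 0 < c₀ → 0 < cA → 0 < A₀ → ∃ β₀ : ℝ, 0 < β₀ ∧ ∀ (a : ℕ → ℝ) (L : ℕ → ℕ), (∀ k, 0 < a k) → Tendsto a atTop (nhds 0) → Tendsto (fun k => a k * L k) atTop atTop → ∀ ℓ₀ : ℝ, 0 < ℓ₀ → let b : ℕ → ℕ := fun k => ⌊ℓ₀ / a k⌋₊; let N : ℕ → ℕ := fun S => 2 * S + 1; let M : ℕ → ℕ → ℕ := fun k S => N S / b k - 1 + 1; let cor : (k S : ℕ) → Site 4 (M k S) → Site 4 (N S) := fun k S y i => ((N S * (y i).val / M k S : ℕ) : ZMod (N S)); let μ : (n : ℕ) → [NeZero n] → Measure (GaugeConfig 4 n G) := fun _ _ => Measure.pi fun _ => haarProbability G; let LF : (k S : ℕ) → GaugeConfig 4 (M k S) G → Finset (Site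 4 (M k S)) := fun _ _ V => Finset.univ.filter fun y => ∃ i j : Fin 4, ε < 3 - (ρ (plaquetteHolonomy V y i j)).trace.re; let AdmAt : ((k S : ℕ) → GaugeConfig 4 (N S) G → ℝ) → (ℕ → ℝ) → ((k S : ℕ) → GaugeConfig 4 (N S) G → GaugeConfig 4 (M k S) G) → ℕ → ℕ → Prop := fun w βe Bl k S => Measurable (w k S) ∧ (0 < ∫ U, w k S U ∂(μ (N S))) ∧ (∀ g U, w k S (gaugeTransform g U) = w k S U) ∧ (∀ v U, w k S (torusConfigShift v U) = w k S U) ∧ (∀ U, w k S (GaugeConfig.timeReflect U) = w k S U) ∧ (∀ (π : Equiv.Perm (Fin 4)) U, w k S (U ∘ fun e => (e.1 ∘ π, π.symm e.2)) = w k S U) ∧ (∀ F : GaugeConfig 4 (N S) G → ℝ, Measurable F → (∃ C, ∀ U, |F U| ≤ C) → IsPositiveTimeObservable F → 0 ≤ ∫ U, F U.timeReflect * F U * w k S U ∂(μ (N S))) ∧ Measurable (Bl k S) ∧ (∀ g U, Bl k S (gaugeTransform g U) = gaugeTransform (g ∘ cor k S) (Bl k S U)) ∧ (∀ e, DependsOn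 (fun U => Bl k S U e) {e' | ∀ i, (e'.1 i - cor k S e.1 i).val ≤ 5 * b k ∨ (cor k S e.1 i - e'.1 i).val ≤ 5 * b k}) ∧ ∃ (A W : QuasiLocalGaugePerturbation 4 (M k S) G 1) (F : Finset (Site 4 (M k S)) → GaugeConfig 4 (M k S) G → ℝ), A.HasAnalyticNormLE ρ (smallFieldDomain ρ 1 r ε) κ A₀ ∧ A.NormLE κ A₀ ∧ (∀ X ∈ polymers 1, (∃ V, A.act X V ≠ 0) → ∀ y ∈ X, ∀ y' ∈ X, ∀ i, (y i - y' i).val ≤ X.card ∨ (y' i - y i).val ≤ X.card) ∧ (∀ V, cA * wilsonAction ρ V ≤ A.total V - A.total fun _ => 1) ∧ W.HasAnalyticNormLE ρ (smallFieldDomain ρ 1 r ε) κ B₀ ∧ W.NormLE κ B₀ ∧ (∀ X ∈ polymers 1, (∃ V, W.act X V ≠ 0) → ∀ y ∈ X, ∀ y' ∈ X, ∀ i, (y i - y' i).val ≤ X.card ∨ (y' i - y i).val ≤ X.card) ∧ (∀ Z, Measurable (F Z)) ∧ (∀ V, F ∅ V = 1) ∧ (∀ Z V, |F Z V| ≤ Real.exp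 (c₀ * Z.card)) ∧ (∀ Z (n : ℕ) V V', (∀ e, (∃ y ∈ Z, ∀ i, (e.1 i - y i).val ≤ n ∨ (y i - e.1 i).val ≤ n) → V e = V' e) → |F Z V - F Z V'| ≤ Real.exp (c₀ * Z.card + κ * (4 - n))) ∧ (∀ Z₁ Z₂ (n : ℕ), (∀ y ∈ Z₁, ∀ y' ∈ Z₂, ∃ i, n < (y i - y' i).val ∧ n < (y' i - y i).val) → ∀ V, |F (Z₁ ∪ Z₂) V - F Z₁ V * F Z₂ V| ≤ Real.exp (c₀ * (Z₁.card + Z₂.card) + κ * (4 - n))) ∧ ∀ Gf, Measurable Gf → (∃ C, ∀ V, |Gf V| ≤ C) → ∫ U, Gf (Bl k S U) * w k S U ∂(μ (N S)) = ∫ V, Gf V * (Real.exp (-(βe k * A.total V) - W.total V) * F (LF k S V) V) ∂(μ (M k S)); ∀ (w : (k S : ℕ) → GaugeConfig 4 (N S) G → ℝ) (βe : ℕ → ℝ) (Bl : (k S : ℕ) → GaugeConfig 4 (N S) G → GaugeConfig 4 (M k S) G), (∃ βl, Tendsto βe atTop (nhds βl)) → (∀ᶠ k in atTop, β₀ ≤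 βe k ∧ ∀ S, L k ≤ S → AdmAt w βe Bl k S) → let E : (k S : ℕ) → (GaugeConfig 4 (N S) G → ℝ) → ℝ := fun k S h => (∫ U, h U * w k S U ∂(μ (N S))) / ∫ U, w k S U ∂(μ (N S)); ∃ Δ : ℝ, 0 < Δ ∧ ∀ h : ℕ, ∃ C : ℝ, ∀ᶠ k in atTop, ∀ S, L k ≤ S → ∀ (t : ℕ) (G₁ G₂ : GaugeConfig 4 (M k S) G → ℝ) (C₁ C₂ : ℝ), 2 * t ≤ M k S → Measurable G₁ → Measurable G₂ → (∀ V, |G₁ V| ≤ C₁) → (∀ V, |G₂ V| ≤ C₂) → (∀ g V, G₁ (gaugeTransform g V) = G₁ V) → (∀ g V, G₂ (gaugeTransform g V) = G₂ V) → DependsOn G₁ {e | (e.1 0).val < h} → DependsOn G₂ {e | (e.1 0).val < h} → |E k S (fun U => G₁ (Bl k S U) * G₂ (torusConfigShift (Pi.single 0 (t : ZMod (M k S))) (Bl k S U))) - E k S (fun U => G₁ (Bl k S U)) * E k S (fun U => G₂ (torusConfigShift (Pi.single 0 (t : ZMod (M k S))) (Bl k S U)))| ≤ C * C₁ * C₂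 * Real.exp (-(Δ * (ℓ₀ * t)))

/-- Named statement of `stub_gaugeAveraging` (verbatim its signature). -/
def Statement.stub_gaugeAveraging : Prop :=
    let G := ↥(Matrix.specialUnitaryGroup (Fin 3) ℂ); let ρ : G →* Matrix (Fin 3) (Fin 3) ℂ := fundamentalRep (Fin 3); ∀ ε r B₀ κ c₀ cA A₀ : ℝ, 0 < ε → 0 < r → 0 < B₀ → 0 < κ → 0 < c₀ → 0 < cA → 0 < A₀ → ∃ β₀ : ℝ, 0 < β₀ ∧ ∀ (a : ℕ → ℝ) (L : ℕ → ℕ), (∀ k, 0 < a k) → Tendsto a atTop (nhds 0) → Tendsto (fun k => a k * L k) atTop atTop → ∀ ℓ₀ : ℝ, 0 < ℓ₀ → let b : ℕ → ℕ := fun k => ⌊ℓ₀ / a k⌋₊; let N : ℕ → ℕ := fun S => 2 * S + 1; let M : ℕ → ℕ → ℕ := fun k S => N S / b k - 1 + 1; let cor : (k S : ℕ) → Site 4 (M k S) → Site 4 (N S) := fun k S y i => ((N S * (y i).val / M k S : ℕ) : ZMod (N S)); let μ : (n : ℕ) → [NeZero n] → Measure (GaugeConfig 4 n G) := fun _ _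 => Measure.pi fun _ => haarProbability G; let LF : (k S : ℕ) → GaugeConfig 4 (M k S) G → Finset (Site 4 (M k S)) := fun _ _ V => Finset.univ.filter fun y => ∃ i j : Fin 4, ε < 3 - (ρ (plaquetteHolonomy V y i j)).trace.re; let AdmAt : ((k S : ℕ) → GaugeConfig 4 (N S) G → ℝ) → (ℕ → ℝ) → ((k S : ℕ) → GaugeConfig 4 (N S) G → GaugeConfig 4 (M k S) G) → ℕ → ℕ → Prop := fun w βe Bl k S => Measurable (w k S) ∧ (0 < ∫ U, w k S U ∂(μ (N S))) ∧ (∀ g U, w k S (gaugeTransform g U) = w k S U) ∧ (∀ v U, w k S (torusConfigShift v U) = w k S U) ∧ (∀ U, w k S (GaugeConfig.timeReflect U) = w k S U) ∧ (∀ (π : Equiv.Perm (Fin 4)) U, w k S (U ∘ fun e => (e.1 ∘ π, π.symm e.2)) = w k S U) ∧ (∀ F : GaugeConfig 4 (N S) G → ℝ, Measurable F → (∃ C, ∀ U, |F U| ≤ C) → IsPositiveTimeObservable F → 0 ≤ ∫ U, F U.timeReflect * F U * w k S U ∂(μ (N S))) ∧ Measurable (Bl k S) ∧ (∀ g U, Bl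 k S (gaugeTransform g U) = gaugeTransform (g ∘ cor k S) (Bl k S U)) ∧ (∀ e, DependsOn (fun U => Bl k S U e) {e' | ∀ i, (e'.1 i - cor k S e.1 i).val ≤ 5 * b k ∨ (cor k S e.1 i - e'.1 i).val ≤ 5 * b k}) ∧ ∃ (A W : QuasiLocalGaugePerturbation 4 (M k S) G 1) (F : Finset (Site 4 (M k S)) → GaugeConfig 4 (M k S) G → ℝ), A.HasAnalyticNormLE ρ (smallFieldDomain ρ 1 r ε) κ A₀ ∧ A.NormLE κ A₀ ∧ (∀ X ∈ polymers 1, (∃ V, A.act X V ≠ 0) → ∀ y ∈ X, ∀ y' ∈ X, ∀ i, (y i - y' i).val ≤ X.card ∨ (y' i - y i).val ≤ X.card) ∧ (∀ V, cA * wilsonAction ρ V ≤ A.total V - A.total fun _ => 1) ∧ W.HasAnalyticNormLE ρ (smallFieldDomain ρ 1 r ε) κ B₀ ∧ W.NormLE κ B₀ ∧ (∀ X ∈ polymers 1, (∃ V, W.act X V ≠ 0) → ∀ y ∈ X, ∀ y' ∈ X, ∀ i, (y i - y' i).val ≤ X.card ∨ (y' i - y i).val ≤ X.card) ∧ (∀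 Z, Measurable (F Z)) ∧ (∀ V, F ∅ V = 1) ∧ (∀ Z V, |F Z V| ≤ Real.exp (c₀ * Z.card)) ∧ (∀ Z (n : ℕ) V V', (∀ e, (∃ y ∈ Z, ∀ i, (e.1 i - y i).val ≤ n ∨ (y i - e.1 i).val ≤ n) → V e = V' e) → |F Z V - F Z V'| ≤ Real.exp (c₀ * Z.card + κ * (4 - n))) ∧ (∀ Z₁ Z₂ (n : ℕ), (∀ y ∈ Z₁, ∀ y' ∈ Z₂, ∃ i, n < (y i - y' i).val ∧ n < (y' i - y i).val) → ∀ V, |F (Z₁ ∪ Z₂) V - F Z₁ V * F Z₂ V| ≤ Real.exp (c₀ * (Z₁.card + Z₂.card) + κ * (4 - n))) ∧ ∀ Gf, Measurable Gf → (∃ C, ∀ V, |Gf V| ≤ C) → ∫ U, Gf (Bl k S U) * w k S U ∂(μ (N S)) = ∫ V, Gf V * (Real.exp (-(βe k * A.total V) - W.total V) * F (LF k S V) V) ∂(μ (M k S)); ∀ (w : (k S : ℕ) → GaugeConfig 4 (N S) G → ℝ) (βe : ℕ → ℝ) (Bl : (k S : ℕ) → GaugeConfig 4 (N S) G → GaugeConfig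 4 (M k S) G), (∃ βl, Tendsto βe atTop (nhds βl)) → (∀ᶠ k in atTop, β₀ ≤ βe k ∧ ∀ S, L k ≤ S → AdmAt w βe Bl k S) → let E : (k S : ℕ) → (GaugeConfig 4 (N S) G → ℝ) → ℝ := fun k S h => (∫ U, h U * w k S U ∂(μ (N S))) / ∫ U, w k S U ∂(μ (N S)); (∀ h : ℕ, ∃ K : ℝ, ∀ᶠ k in atTop, ∀ S, L k ≤ S → ∀ (G₀ : GaugeConfig 4 (M k S) G → ℝ) (C₀ : ℝ) (s : ZMod (M k S)), Measurable G₀ → (∀ V, |G₀ V| ≤ C₀) → DependsOn G₀ {e | (e.1 0 - s).val < h} → |E k S (fun U => G₀ (Bl k S U))| ≤ K * C₀) → (∃ Δ : ℝ, 0 < Δ ∧ ∀ h : ℕ, ∃ C : ℝ, ∀ᶠ k in atTop, ∀ S, L k ≤ S → ∀ (t : ℕ) (G₁ G₂ : GaugeConfig 4 (M k S) G → ℝ) (C₁ C₂ : ℝ), 2 * t ≤ M k S → Measurable G₁ → Measurable G₂ → (∀ V, |G₁ V| ≤ C₁) → (∀ V, |G₂ V| ≤ C₂) → (∀ g V, G₁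 (gaugeTransform g V) = G₁ V) → (∀ g V, G₂ (gaugeTransform g V) = G₂ V) → DependsOn G₁ {e | (e.1 0).val < h} → DependsOn G₂ {e | (e.1 0).val < h} → |E k S (fun U => G₁ (Bl k S U) * G₂ (torusConfigShift (Pi.single 0 (t : ZMod (M k S))) (Bl k S U))) - E k S (fun U => G₁ (Bl k S U)) * E k S (fun U => G₂ (torusConfigShift (Pi.single 0 (t : ZMod (M k S))) (Bl k S U)))| ≤ C * C₁ * C₂ * Real.exp (-(Δ * (ℓ₀ * t)))) → ∃ Δ : ℝ, 0 < Δ ∧ ∀ h : ℕ, ∃ C : ℝ, ∀ᶠ k in atTop, ∀ S, L k ≤ S → ∀ (t : ℕ) (G₁ G₂ : GaugeConfig 4 (M k S) G → ℝ) (C₁ C₂ : ℝ), 2 * t ≤ M k S → Measurable G₁ → Measurable G₂ → (∀ V, |G₁ V| ≤ C₁) → (∀ V, |G₂ V| ≤ C₂) → DependsOn G₁ {e | (e.1 0).val < h} → DependsOn G₂ {e | (e.1 0).val < h} → |E k S (fun U => G₁ (Bl k S U) * G₂ (torusConfigShift (Pi.single 0 (t : ZMod (M k S))) (Bl k S U)))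 - E k S (fun U => G₁ (Bl k S U)) * E k S (fun U => G₂ (torusConfigShift (Pi.single 0 (t : ZMod (M k S))) (Bl k S U)))| ≤ C * C₁ * C₂ * Real.exp (-(Δ * (ℓ₀ * t)))

/-! ### The stubs (registered: `theorem stub_<name> : <signature> := by sorry`) -/

/-! #### Stub 1 reshaped (lead, wave 2, 2026-08-17): the slab state bound IS the positivity of the blocked law

Worker W-SSB's verdict on the registered `stub_slabStateBound` (file `work/stubs/StubSlabStateBound.lean`,
attached as evidence): `stub-blocked` — modulo the one-line estimate `abs_integral_comp_mul_le_of_nonneg`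
the stub is the REALISABILITY ⇒ POSITIVITY fact `BlockedLawNonneg` below, which (i) the
reflection-positivity / invariance clauses (1)–(10) of `AdmAt` do NOT give (explicit signed, RP,
lattice-invariant weight `w = ∏_{axis lines} ψ(hol)` with `ψ` central, `∫ψ > 0`, `ψ < 0` somewhere:
its normalised slab states grow like `(∫|ψ|/∫ψ)^{3M²h}` under straight decimation), and (ii) the
format clause (11) alone does not give either (`formatBallClustering_false` below). So the registered
stub is now `stub_blockedLawNonneg`, and `stub_slabStateBound`'s statement is PROVED from it (K = 1). -/

/-- **The missing realisability fact** (`BlockedLawNonneg`, typed by W-SSB over the verbatim context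
of the crux): in the admissible context, eventually in `k` and for all `S ≥ L k`, the
`Bl k S`-pushforward of the signed fine measure `w k S · μ_N` is a positive measure —
`0 ≤ ∫ Gf (Bl k S U) * w k S U ∂μ_N` for every bounded measurable block functional `Gf ≥ 0`
(through the pushforward clause of `AdmAt`: `0 ≤ F (LF k S V) V` for `μ_M`-a.e. `V`). Trivially true
for `0 ≤ w`; for the signed reflection-positive class uncertified either way; FALSE iff an admissible
signed member exists (which would also refute the crux at `t = 0`). [folklore] -/
def BlockedLawNonneg : Prop :=
    let G := ↥(Matrix.specialUnitaryGroup (Fin 3) ℂ); let ρ : G →* Matrix (Fin 3) (Fin 3) ℂ := fundamentalRep (Fin 3); ∀ ε r B₀ κ c₀ cA A₀ : ℝ, 0 < ε → 0 < r → 0 < B₀ → 0 < κ → 0 < c₀ → 0 < cA → 0 < A₀ → ∃ β₀ : ℝ, 0 < β₀ ∧ ∀ (a : ℕ → ℝ) (L : ℕ → ℕ), (∀ k, 0 < a k) → Tendsto a atTop (nhds 0) → Tendsto (fun k => a k * L k) atTop atTop → ∀ ℓ₀ : ℝ, 0 < ℓ₀ → let b : ℕ → ℕ := fun k => ⌊ℓ₀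 / a k⌋₊; let N : ℕ → ℕ := fun S => 2 * S + 1; let M : ℕ → ℕ → ℕ := fun k S => N S / b k - 1 + 1; let cor : (k S : ℕ) → Site 4 (M k S) → Site 4 (N S) := fun k S y i => ((N S * (y i).val / M k S : ℕ) : ZMod (N S)); let μ : (n : ℕ) → [NeZero n] → Measure (GaugeConfig 4 n G) := fun _ _ => Measure.pi fun _ => haarProbability G; let LF : (k S : ℕ) → GaugeConfig 4 (M k S) G → Finset (Site 4 (M k S)) := fun _ _ V => Finset.univ.filter fun y => ∃ i j : Fin 4, ε < 3 - (ρ (plaquetteHolonomy V y i j)).trace.re; let AdmAt : ((k S : ℕ) → GaugeConfig 4 (N S) G → ℝ) → (ℕ → ℝ) → ((k S : ℕ) → GaugeConfig 4 (N S) G → GaugeConfig 4 (M k S) G) → ℕ → ℕ → Prop := fun w βe Bl k S => Measurable (w k S) ∧ (0 < ∫ U, w k S U ∂(μ (N S))) ∧ (∀ g U, w k S (gaugeTransform g U) = w k S U) ∧ (∀ v U, w k S (torusConfigShift v U) = w k S U) ∧ (∀ U, w k S (GaugeConfig.timeReflect U) = w k S U) ∧ (∀ (π : Equiv.Perm (Fin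 4)) U, w k S (U ∘ fun e => (e.1 ∘ π, π.symm e.2)) = w k S U) ∧ (∀ F : GaugeConfig 4 (N S) G → ℝ, Measurable F → (∃ C, ∀ U, |F U| ≤ C) → IsPositiveTimeObservable F → 0 ≤ ∫ U, F U.timeReflect * F U * w k S U ∂(μ (N S))) ∧ Measurable (Bl k S) ∧ (∀ g U, Bl k S (gaugeTransform g U) = gaugeTransform (g ∘ cor k S) (Bl k S U)) ∧ (∀ e, DependsOn (fun U => Bl k S U e) {e' | ∀ i, (e'.1 i - cor k S e.1 i).val ≤ 5 * b k ∨ (cor k S e.1 i - e'.1 i).val ≤ 5 * b k}) ∧ ∃ (A W : QuasiLocalGaugePerturbation 4 (M k S) G 1) (F : Finset (Site 4 (M k S)) → GaugeConfig 4 (M k S) G → ℝ), A.HasAnalyticNormLE ρ (smallFieldDomain ρ 1 r ε) κ A₀ ∧ A.NormLE κ A₀ ∧ (∀ X ∈ polymers 1, (∃ V, A.act X V ≠ 0) → ∀ y ∈ X, ∀ y' ∈ X, ∀ i, (y i - y' i).val ≤ X.card ∨ (y' i - y i).val ≤ X.card) ∧ (∀ V, cA * wilsonAction ρ V ≤ A.total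 V - A.total fun _ => 1) ∧ W.HasAnalyticNormLE ρ (smallFieldDomain ρ 1 r ε) κ B₀ ∧ W.NormLE κ B₀ ∧ (∀ X ∈ polymers 1, (∃ V, W.act X V ≠ 0) → ∀ y ∈ X, ∀ y' ∈ X, ∀ i, (y i - y' i).val ≤ X.card ∨ (y' i - y i).val ≤ X.card) ∧ (∀ Z, Measurable (F Z)) ∧ (∀ V, F ∅ V = 1) ∧ (∀ Z V, |F Z V| ≤ Real.exp (c₀ * Z.card)) ∧ (∀ Z (n : ℕ) V V', (∀ e, (∃ y ∈ Z, ∀ i, (e.1 i - y i).val ≤ n ∨ (y i - e.1 i).val ≤ n) → V e = V' e) → |F Z V - F Z V'| ≤ Real.exp (c₀ * Z.card + κ * (4 - n))) ∧ (∀ Z₁ Z₂ (n : ℕ), (∀ y ∈ Z₁, ∀ y' ∈ Z₂, ∃ i, n < (y i - y' i).val ∧ n < (y' i - y i).val) → ∀ V, |F (Z₁ ∪ Z₂) V - F Z₁ V * F Z₂ V| ≤ Real.exp (c₀ * (Z₁.card + Z₂.card) + κ * (4 - n))) ∧ ∀ Gf, Measurable Gf → (∃ C, ∀ V, |Gf V|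 ≤ C) → ∫ U, Gf (Bl k S U) * w k S U ∂(μ (N S)) = ∫ V, Gf V * (Real.exp (-(βe k * A.total V) - W.total V) * F (LF k S V) V) ∂(μ (M k S)); ∀ (w : (k S : ℕ) → GaugeConfig 4 (N S) G → ℝ) (βe : ℕ → ℝ) (Bl : (k S : ℕ) → GaugeConfig 4 (N S) G → GaugeConfig 4 (M k S) G), (∃ βl, Tendsto βe atTop (nhds βl)) → (∀ᶠ k in atTop, β₀ ≤ βe k ∧ ∀ S, L k ≤ S → AdmAt w βe Bl k S) → ∀ᶠ k in atTop, ∀ S, L k ≤ S → ∀ Gf : GaugeConfig 4 (M k S) G → ℝ, Measurable Gf → (∃ C, ∀ V, |Gf V| ≤ C) → (∀ V, 0 ≤ Gf V) → 0 ≤ ∫ U, Gf (Bl k S U) * w k S U ∂(μ (N S))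

/-- **Stub 1′ — the blocked law of an admissible family is a positive measure** (registered; the
sign question of the crux in its sharpest form; see `BlockedLawNonneg`). Why plausibly true: the
planners intend Bałaban block averaging of reflection-positive fine theories, and for `w ≥ 0` it is
trivial; why it might fail: a signed RP fine weight whose coercive-format pushforward keeps an
extensive sign (none certified). Size: unknown (named condition). [folklore] -/
theorem stub_blockedLawNonneg :
    let G := ↥(Matrix.specialUnitaryGroup (Fin 3) ℂ); let ρ : G →* Matrix (Fin 3) (Fin 3) ℂ := fundamentalRep (Fin 3); ∀ ε r B₀ κ c₀ cA A₀ : ℝ, 0 < ε → 0 < r → 0 < B₀ → 0 < κ → 0 < c₀ → 0 < cA → 0 < A₀ → ∃ β₀ : ℝ, 0 < β₀ ∧ ∀ (a : ℕ → ℝ) (L : ℕ → ℕ), (∀ k, 0 < a k) → Tendsto a atTop (nhds 0) → Tendsto (fun k => a k * L k) atTop atTop → ∀ ℓ₀ : ℝ, 0 < ℓ₀ → let b : ℕ → ℕ := fun k => ⌊ℓ₀ / a k⌋₊; let N : ℕ → ℕ := fun S => 2 * S + 1; let M : ℕ → ℕ → ℕ := fun k S => N S / b k - 1 + 1; let cor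 : (k S : ℕ) → Site 4 (M k S) → Site 4 (N S) := fun k S y i => ((N S * (y i).val / M k S : ℕ) : ZMod (N S)); let μ : (n : ℕ) → [NeZero n] → Measure (GaugeConfig 4 n G) := fun _ _ => Measure.pi fun _ => haarProbability G; let LF : (k S : ℕ) → GaugeConfig 4 (M k S) G → Finset (Site 4 (M k S)) := fun _ _ V => Finset.univ.filter fun y => ∃ i j : Fin 4, ε < 3 - (ρ (plaquetteHolonomy V y i j)).trace.re; let AdmAt : ((k S : ℕ) → GaugeConfig 4 (N S) G → ℝ) → (ℕ → ℝ) → ((k S : ℕ) → GaugeConfig 4 (N S) G → GaugeConfig 4 (M k S) G) → ℕ → ℕ → Prop := fun w βe Bl k S => Measurable (w k S) ∧ (0 < ∫ U, w k S U ∂(μ (N S))) ∧ (∀ g U, w k S (gaugeTransform g U) = w k S U) ∧ (∀ v U, w k S (torusConfigShift v U) = w k S U) ∧ (∀ U, w k S (GaugeConfig.timeReflect U) = w k S U) ∧ (∀ (π : Equiv.Perm (Fin 4)) U, w k S (U ∘ fun e => (e.1 ∘ π, π.symm e.2)) = w k S U) ∧ (∀ F : GaugeConfig 4 (N S) G → ℝ,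 Measurable F → (∃ C, ∀ U, |F U| ≤ C) → IsPositiveTimeObservable F → 0 ≤ ∫ U, F U.timeReflect * F U * w k S U ∂(μ (N S))) ∧ Measurable (Bl k S) ∧ (∀ g U, Bl k S (gaugeTransform g U) = gaugeTransform (g ∘ cor k S) (Bl k S U)) ∧ (∀ e, DependsOn (fun U => Bl k S U e) {e' | ∀ i, (e'.1 i - cor k S e.1 i).val ≤ 5 * b k ∨ (cor k S e.1 i - e'.1 i).val ≤ 5 * b k}) ∧ ∃ (A W : QuasiLocalGaugePerturbation 4 (M k S) G 1) (F : Finset (Site 4 (M k S)) → GaugeConfig 4 (M k S) G → ℝ), A.HasAnalyticNormLE ρ (smallFieldDomain ρ 1 r ε) κ A₀ ∧ A.NormLE κ A₀ ∧ (∀ X ∈ polymers 1, (∃ V, A.act X V ≠ 0) → ∀ y ∈ X, ∀ y' ∈ X, ∀ i, (y i - y' i).val ≤ X.card ∨ (y' i - y i).val ≤ X.card) ∧ (∀ V, cA * wilsonAction ρ V ≤ A.total V - A.total fun _ => 1) ∧ W.HasAnalyticNormLE ρ (smallFieldDomain ρ 1 r ε) κ B₀ ∧ W.NormLE κ B₀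 ∧ (∀ X ∈ polymers 1, (∃ V, W.act X V ≠ 0) → ∀ y ∈ X, ∀ y' ∈ X, ∀ i, (y i - y' i).val ≤ X.card ∨ (y' i - y i).val ≤ X.card) ∧ (∀ Z, Measurable (F Z)) ∧ (∀ V, F ∅ V = 1) ∧ (∀ Z V, |F Z V| ≤ Real.exp (c₀ * Z.card)) ∧ (∀ Z (n : ℕ) V V', (∀ e, (∃ y ∈ Z, ∀ i, (e.1 i - y i).val ≤ n ∨ (y i - e.1 i).val ≤ n) → V e = V' e) → |F Z V - F Z V'| ≤ Real.exp (c₀ * Z.card + κ * (4 - n))) ∧ (∀ Z₁ Z₂ (n : ℕ), (∀ y ∈ Z₁, ∀ y' ∈ Z₂, ∃ i, n < (y i - y' i).val ∧ n < (y' i - y i).val) → ∀ V, |F (Z₁ ∪ Z₂) V - F Z₁ V * F Z₂ V| ≤ Real.exp (c₀ * (Z₁.card + Z₂.card) + κ * (4 - n))) ∧ ∀ Gf, Measurable Gf → (∃ C, ∀ V, |Gf V| ≤ C) → ∫ U, Gf (Bl k S U) * w k S U ∂(μ (N S)) = ∫ V, Gf V * (Real.exp (-(βe k * A.total V) - W.total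 V) * F (LF k S V) V) ∂(μ (M k S)); ∀ (w : (k S : ℕ) → GaugeConfig 4 (N S) G → ℝ) (βe : ℕ → ℝ) (Bl : (k S : ℕ) → GaugeConfig 4 (N S) G → GaugeConfig 4 (M k S) G), (∃ βl, Tendsto βe atTop (nhds βl)) → (∀ᶠ k in atTop, β₀ ≤ βe k ∧ ∀ S, L k ≤ S → AdmAt w βe Bl k S) → ∀ᶠ k in atTop, ∀ S, L k ≤ S → ∀ Gf : GaugeConfig 4 (M k S) G → ℝ, Measurable Gf → (∃ C, ∀ V, |Gf V| ≤ C) → (∀ V, 0 ≤ Gf V) → 0 ≤ ∫ U, Gf (Bl k S U) * w k S U ∂(μ (N S)) := by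
  sorry

/-- **Positivity of the pushforward functional bounds the un-normalised state**: if
`Gf ↦ ∫ Gf (Bl U) * w U ∂μ` is non-negative on bounded measurable `Gf ≥ 0`, then
`|∫ G₀ (Bl U) * w U ∂μ| ≤ C₀ * ∫ w ∂μ` whenever `|G₀| ≤ C₀` (apply positivity to `C₀ - G₀` and
`C₀ + G₀`). [folklore] -/
theorem abs_integral_comp_mul_le_of_nonneg {Ω Ω' : Type*} [MeasurableSpace Ω]
    [MeasurableSpace Ω'] {μ : Measure Ω} {w : Ω → ℝ} {Bl : Ω → Ω'} (hw : Integrable w μ)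
    (hBl : Measurable Bl)
    (hpos : ∀ Gf : Ω' → ℝ, Measurable Gf → (∃ C, ∀ V, |Gf V| ≤ C) → (∀ V, 0 ≤ Gf V) →
      0 ≤ ∫ U, Gf (Bl U) * w U ∂μ)
    {G₀ : Ω' → ℝ} {C₀ : ℝ} (hG₀ : Measurable G₀) (hb : ∀ V, |G₀ V| ≤ C₀) :
    |∫ U, G₀ (Bl U) * w U ∂μ| ≤ C₀ * ∫ U, w U ∂μ := by
  have hint : Integrable (fun U => G₀ (Bl U) * w U) μ :=
    hw.bdd_mul (hG₀.comp hBl).aestronglyMeasurable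
      (ae_of_all μ fun U => (Real.norm_eq_abs _).trans_le (hb (Bl U)))
  have h1 : 0 ≤ ∫ U, (C₀ - G₀ (Bl U)) * w U ∂μ :=
    hpos (fun V => C₀ - G₀ V) (measurable_const.sub hG₀)
      ⟨C₀ + C₀, fun V => by
        obtain ⟨h₁, h₂⟩ := abs_le.1 (hb V)
        rw [abs_le]; constructor <;> linarith⟩
      (fun V => by
        obtain ⟨h₁, h₂⟩ := abs_le.1 (hb V)
        linarith)
  have h2 : 0 ≤ ∫ U, (C₀ + G₀ (Bl U)) * w U ∂μ :=
    hpos (fun V => C₀ + G₀ V) (measurable_const.add hG₀)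
      ⟨C₀ + C₀, fun V => by
        obtain ⟨h₁, h₂⟩ := abs_le.1 (hb V)
        rw [abs_le]; constructor <;> linarith⟩
      (fun V => by
        obtain ⟨h₁, h₂⟩ := abs_le.1 (hb V)
        linarith)
  have e1 : ∫ U, (C₀ - G₀ (Bl U)) * w U ∂μ = C₀ * ∫ U, w U ∂μ - ∫ U, G₀ (Bl U) * w U ∂μ := by
    simp_rw [sub_mul]
    rw [integral_sub (hw.const_mul C₀) hint, integral_const_mul]
  have e2 : ∫ U, (C₀ + G₀ (Bl U)) * w U ∂μ = C₀ * ∫ U, w U ∂μ + ∫ U, G₀ (Bl U) * w U ∂μ := by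
    simp_rw [add_mul]
    rw [integral_add (hw.const_mul C₀) hint, integral_const_mul]
  rw [e1] at h1
  rw [e2] at h2
  rw [abs_le]
  constructor <;> linarith

/-- **Stub 1 from Stub 1′** (W-SSB, `K = 1`): if the blocked law is a positive measure then the
normalised state is bounded by `sup |G₀|` on every bounded measurable block observable — in
particular on every slab, at every base time, uniformly in the volume (the registered statement
`Statement.stub_slabStateBound`, verbatim). Uses only `Measurable (w k S)`, `0 < ∫ w k S`,
`Measurable (Bl k S)` of `AdmAt`. [folklore] -/
theorem slabStateBound_of_blockedLawNonneg (H : BlockedLawNonneg) : Statement.stub_slabStateBound := by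
  intro ε r B₀ κ c₀ cA A₀ hε hr hB₀ hκ hc₀ hcA hA₀
  obtain ⟨β₀, hβ₀, H₀⟩ := H ε r B₀ κ c₀ cA A₀ hε hr hB₀ hκ hc₀ hcA hA₀
  refine ⟨β₀, hβ₀, ?_⟩
  intro a L ha ha0 haL ℓ₀ hℓ₀ b N M cor μ LF AdmAt w βe Bl hβe hadm E h
  refine ⟨1, ?_⟩
  have Hpos := H₀ a L ha ha0 haL ℓ₀ hℓ₀ w βe Bl hβe hadm
  filter_upwards [hadm, Hpos] with k hk hposk
  intro S hS G₀ C₀ s hG₀m hG₀b hG₀dep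
  obtain ⟨hwm, hwpos, -, -, -, -, -, hBlm, -, -, -⟩ := hk.2 S hS
  have hwi : Integrable (w k S) (μ (N S)) := by
    by_contra hni
    rw [integral_undef hni] at hwpos
    exact lt_irrefl _ hwpos
  have key : |∫ U, G₀ (Bl k S U) * w k S U ∂(μ (N S))| ≤ C₀ * ∫ U, w k S U ∂(μ (N S)) :=
    abs_integral_comp_mul_le_of_nonneg hwi hBlm (hposk S hS) hG₀m hG₀b
  have hE : E k S (fun U => G₀ (Bl k S U)) =
      (∫ U, G₀ (Bl k S U) * w k S U ∂(μ (N S))) / ∫ U, w k S U ∂(μ (N S)) := rfl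
  rw [hE, abs_div, abs_of_pos hwpos, div_le_iff₀ hwpos, one_mul]
  exact key


/-! #### Stub 2 reshaped (lead, wave 2, 2026-08-17): the core, cut at realisability

`stub_gaugeInvariantClustering` (the crux's conclusion for gauge-invariant slab observables, in the
admissible context) is split into the positivity fact `BlockedLawNonneg` (shared with Stub 1′), the
CONTEXT-FREE core `PositiveInvariantFormatClustering` — uniform slab clustering of gauge-invariant
observables under every normalised POSITIVE coercive-format density on the block torus, couplings in
a compact window above the threshold (the af-funnel transfer target `FormatBallClustering` re-typed
with `0 ≤ F` and invariant observables: the only re-typing that survives `formatBallClustering_false`)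
— and the provable transfer `stub_positiveTransfer` (pushforward bookkeeping + the `|F|`-repair). -/

/-- **The context-free core** (`PositiveInvariantFormatClustering`): for all format constants there
is `β₀` such that for every window `[β₀, β₁]` one rate `Δ > 0` and per slab thickness one `C` give,
on EVERY block torus `(ZMod M)^4` and for EVERY `(βe, A, W, F)` in the coercive Bałaban format with
`0 ≤ F`, uniform slab clustering of bounded measurable GAUGE-INVARIANT observables under the
normalised density `exp(−βe A − W) F(LF V, V) dHaar`, rate `Δ` in block units. Physics: the
volume-uniform mass gap of every weakly coupled coercive-format `SU(3)` lattice gauge theory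
(universality of the gapped phase at one block scale) — Yang–Mills-grade, the honest kernel of the
crux. [folklore] -/
def PositiveInvariantFormatClustering : Prop :=
  let G := ↥(Matrix.specialUnitaryGroup (Fin 3) ℂ)
  let ρ : G →* Matrix (Fin 3) (Fin 3) ℂ := fundamentalRep (Fin 3)
  ∀ ε r B₀ κ c₀ cA A₀ : ℝ, 0 < ε → 0 < r → 0 < B₀ → 0 < κ → 0 < c₀ → 0 < cA → 0 < A₀ →
  ∃ β₀ : ℝ, 0 < β₀ ∧ ∀ β₁ : ℝ, β₀ ≤ β₁ →
  ∃ Δ : ℝ, 0 < Δ ∧ ∀ h : ℕ, ∃ C : ℝ, ∀ (M : ℕ) [NeZero M],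
  let μ : Measure (GaugeConfig 4 M G) := Measure.pi fun _ => haarProbability G
  let LF : GaugeConfig 4 M G → Finset (Site 4 M) := fun V =>
    Finset.univ.filter fun y => ∃ i j : Fin 4, ε < 3 - (ρ (plaquetteHolonomy V y i j)).trace.re
  ∀ (βe : ℝ) (A W : QuasiLocalGaugePerturbation 4 M G 1)
    (F : Finset (Site 4 M) → GaugeConfig 4 M G → ℝ),
  β₀ ≤ βe → βe ≤ β₁ →
  A.HasAnalyticNormLE ρ (smallFieldDomain ρ 1 r ε) κ A₀ → A.NormLE κ A₀ →
  (∀ X ∈ polymers 1, (∃ V, A.act X V ≠ 0) →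
    ∀ y ∈ X, ∀ y' ∈ X, ∀ i, (y i - y' i).val ≤ X.card ∨ (y' i - y i).val ≤ X.card) →
  (∀ V, cA * wilsonAction ρ V ≤ A.total V - A.total fun _ => 1) →
  W.HasAnalyticNormLE ρ (smallFieldDomain ρ 1 r ε) κ B₀ → W.NormLE κ B₀ →
  (∀ X ∈ polymers 1, (∃ V, W.act X V ≠ 0) →
    ∀ y ∈ X, ∀ y' ∈ X, ∀ i, (y i - y' i).val ≤ X.card ∨ (y' i - y i).val ≤ X.card) →
  (∀ Z, Measurable (F Z)) → (∀ V, F ∅ V = 1) → (∀ Z V, |F Z V| ≤ Real.exp (c₀ * Z.card)) →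
  (∀ Z V, 0 ≤ F Z V) →
  (∀ Z (n : ℕ) V V', (∀ e, (∃ y ∈ Z, ∀ i, (e.1 i - y i).val ≤ n ∨ (y i - e.1 i).val ≤ n) →
      V e = V' e) → |F Z V - F Z V'| ≤ Real.exp (c₀ * Z.card + κ * (4 - n))) →
  (∀ Z₁ Z₂ (n : ℕ), (∀ y ∈ Z₁, ∀ y' ∈ Z₂, ∃ i, n < (y i - y' i).val ∧ n < (y' i - y i).val) →
      ∀ V, |F (Z₁ ∪ Z₂) V - F Z₁ V * F Z₂ V| ≤ Real.exp (c₀ * (Z₁.card + Z₂.card) + κ * (4 - n))) →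
  let dens : GaugeConfig 4 M G → ℝ := fun V =>
    Real.exp (-(βe * A.total V) - W.total V) * F (LF V) V
  let E : (GaugeConfig 4 M G → ℝ) → ℝ := fun G₀ => (∫ V, G₀ V * dens V ∂μ) / ∫ V, dens V ∂μ
  (0 < ∫ V, dens V ∂μ) →
  ∀ (t : ℕ) (G₁ G₂ : GaugeConfig 4 M G → ℝ) (C₁ C₂ : ℝ), 2 * t ≤ M →
  Measurable G₁ → Measurable G₂ → (∀ V, |G₁ V| ≤ C₁) → (∀ V, |G₂ V| ≤ C₂) →
  (∀ g V, G₁ (gaugeTransform g V) = G₁ V) → (∀ g V, G₂ (gaugeTransform g V) = G₂ V) →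
  DependsOn G₁ {e | (e.1 0).val < h} → DependsOn G₂ {e | (e.1 0).val < h} →
  |E (fun V => G₁ V * G₂ (torusConfigShift (Pi.single 0 (t : ZMod M)) V))
    - E G₁ * E (fun V => G₂ (torusConfigShift (Pi.single 0 (t : ZMod M)) V))|
    ≤ C * C₁ * C₂ * Real.exp (-(Δ * t))

/-- **Stub 2′ — THE CORE** (registered): `PositiveInvariantFormatClustering`. Why plausibly true:
the route's bet (gapped phase of weakly coupled `SU(3)` in the coercive format, Higgs/Coulomb phases
excluded by quasi-locality, first-order lines excluded by `β₀ ≫ B₀/cA`); why it might fail: it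
contains the lattice Yang–Mills mass gap for the perfect-action class, and the format class also
holds weakly coupled Lorentz-violating members (FINDINGS-r1-k1-rev3 R2). Size: XL (open problem).
[cite: Balaban1989LargeFieldII] [cite: Balaban1988Convergent] [cite: JaffeWitten2000] -/
theorem stub_positiveInvariantFormatClustering : PositiveInvariantFormatClustering := by
  sorry

/-- The registered statement of the (old) Stub 2, as a plain named proposition (verbatim
`Statement.stub_gaugeInvariantClustering`; a dot-free name so that a Theorems file can render it by a
local notation). [folklore] -/
def GaugeInvariantClustering : Prop :=
    let G := ↥(Matrix.specialUnitaryGroup (Fin 3) ℂ); let ρ : G →* Matrix (Fin 3) (Fin 3) ℂ := fundamentalRep (Fin 3); ∀ ε r B₀ κ c₀ cA A₀ : ℝ, 0 < ε → 0 < r → 0 < B₀ → 0 < κ → 0 < c₀ → 0 < cA → 0 < A₀ → ∃ β₀ : ℝ, 0 < β₀ ∧ ∀ (a : ℕ → ℝ) (L : ℕ → ℕ), (∀ k, 0 < a k) → Tendsto a atTop (nhds 0) → Tendsto (fun k => a k * L k) atTop atTop → ∀ ℓ₀ : ℝ, 0 < ℓ₀ → let b : ℕ → ℕ := fun k => ⌊ℓ₀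 / a k⌋₊; let N : ℕ → ℕ := fun S => 2 * S + 1; let M : ℕ → ℕ → ℕ := fun k S => N S / b k - 1 + 1; let cor : (k S : ℕ) → Site 4 (M k S) → Site 4 (N S) := fun k S y i => ((N S * (y i).val / M k S : ℕ) : ZMod (N S)); let μ : (n : ℕ) → [NeZero n] → Measure (GaugeConfig 4 n G) := fun _ _ => Measure.pi fun _ => haarProbability G; let LF : (k S : ℕ) → GaugeConfig 4 (M k S) G → Finset (Site 4 (M k S)) := fun _ _ V => Finset.univ.filter fun y => ∃ i j : Fin 4, ε < 3 - (ρ (plaquetteHolonomy V y i j)).trace.re; let AdmAt : ((k S : ℕ) → GaugeConfig 4 (N S) G → ℝ) → (ℕ → ℝ) → ((k S : ℕ) → GaugeConfig 4 (N S) G → GaugeConfig 4 (M k S) G) → ℕ → ℕ → Prop := fun w βe Bl k S => Measurable (w k S) ∧ (0 < ∫ U, w k S U ∂(μ (N S))) ∧ (∀ g U, w k S (gaugeTransform g U) = w k S U) ∧ (∀ v U, w k S (torusConfigShift v U) = w k S U) ∧ (∀ U, w k S (GaugeConfig.timeReflect U) = w k S U) ∧ (∀ (π : Equiv.Perm (Fin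 4)) U, w k S (U ∘ fun e => (e.1 ∘ π, π.symm e.2)) = w k S U) ∧ (∀ F : GaugeConfig 4 (N S) G → ℝ, Measurable F → (∃ C, ∀ U, |F U| ≤ C) → IsPositiveTimeObservable F → 0 ≤ ∫ U, F U.timeReflect * F U * w k S U ∂(μ (N S))) ∧ Measurable (Bl k S) ∧ (∀ g U, Bl k S (gaugeTransform g U) = gaugeTransform (g ∘ cor k S) (Bl k S U)) ∧ (∀ e, DependsOn (fun U => Bl k S U e) {e' | ∀ i, (e'.1 i - cor k S e.1 i).val ≤ 5 * b k ∨ (cor k S e.1 i - e'.1 i).val ≤ 5 * b k}) ∧ ∃ (A W : QuasiLocalGaugePerturbation 4 (M k S) G 1) (F : Finset (Site 4 (M k S)) → GaugeConfig 4 (M k S) G → ℝ), A.HasAnalyticNormLE ρ (smallFieldDomain ρ 1 r ε) κ A₀ ∧ A.NormLE κ A₀ ∧ (∀ X ∈ polymers 1, (∃ V, A.act X V ≠ 0) → ∀ y ∈ X, ∀ y' ∈ X, ∀ i, (y i - y' i).val ≤ X.card ∨ (y' i - y i).val ≤ X.card) ∧ (∀ V, cA * wilsonAction ρ V ≤ A.total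 V - A.total fun _ => 1) ∧ W.HasAnalyticNormLE ρ (smallFieldDomain ρ 1 r ε) κ B₀ ∧ W.NormLE κ B₀ ∧ (∀ X ∈ polymers 1, (∃ V, W.act X V ≠ 0) → ∀ y ∈ X, ∀ y' ∈ X, ∀ i, (y i - y' i).val ≤ X.card ∨ (y' i - y i).val ≤ X.card) ∧ (∀ Z, Measurable (F Z)) ∧ (∀ V, F ∅ V = 1) ∧ (∀ Z V, |F Z V| ≤ Real.exp (c₀ * Z.card)) ∧ (∀ Z (n : ℕ) V V', (∀ e, (∃ y ∈ Z, ∀ i, (e.1 i - y i).val ≤ n ∨ (y i - e.1 i).val ≤ n) → V e = V' e) → |F Z V - F Z V'| ≤ Real.exp (c₀ * Z.card + κ * (4 - n))) ∧ (∀ Z₁ Z₂ (n : ℕ), (∀ y ∈ Z₁, ∀ y' ∈ Z₂, ∃ i, n < (y i - y' i).val ∧ n < (y' i - y i).val) → ∀ V, |F (Z₁ ∪ Z₂) V - F Z₁ V * F Z₂ V| ≤ Real.exp (c₀ * (Z₁.card + Z₂.card) + κ * (4 - n))) ∧ ∀ Gf, Measurable Gf → (∃ C, ∀ V, |Gf V|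 ≤ C) → ∫ U, Gf (Bl k S U) * w k S U ∂(μ (N S)) = ∫ V, Gf V * (Real.exp (-(βe k * A.total V) - W.total V) * F (LF k S V) V) ∂(μ (M k S)); ∀ (w : (k S : ℕ) → GaugeConfig 4 (N S) G → ℝ) (βe : ℕ → ℝ) (Bl : (k S : ℕ) → GaugeConfig 4 (N S) G → GaugeConfig 4 (M k S) G), (∃ βl, Tendsto βe atTop (nhds βl)) → (∀ᶠ k in atTop, β₀ ≤ βe k ∧ ∀ S, L k ≤ S → AdmAt w βe Bl k S) → let E : (k S : ℕ) → (GaugeConfig 4 (N S) G → ℝ) → ℝ := fun k S h => (∫ U, h U * w k S U ∂(μ (N S))) / ∫ U, w k S U ∂(μ (N S)); ∃ Δ : ℝ, 0 < Δ ∧ ∀ h : ℕ, ∃ C : ℝ, ∀ᶠ k in atTop, ∀ S, L k ≤ S → ∀ (t : ℕ) (G₁ G₂ : GaugeConfig 4 (M k S) G → ℝ) (C₁ C₂ : ℝ), 2 * t ≤ M k S → Measurable G₁ → Measurable G₂ → (∀ V, |G₁ V| ≤ C₁) → (∀ V, |G₂ V| ≤ C₂) → (∀ g V, G₁ (gaugeTransform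 g V) = G₁ V) → (∀ g V, G₂ (gaugeTransform g V) = G₂ V) → DependsOn G₁ {e | (e.1 0).val < h} → DependsOn G₂ {e | (e.1 0).val < h} → |E k S (fun U => G₁ (Bl k S U) * G₂ (torusConfigShift (Pi.single 0 (t : ZMod (M k S))) (Bl k S U))) - E k S (fun U => G₁ (Bl k S U)) * E k S (fun U => G₂ (torusConfigShift (Pi.single 0 (t : ZMod (M k S))) (Bl k S U)))| ≤ C * C₁ * C₂ * Real.exp (-(Δ * (ℓ₀ * t)))

-- stub_positiveTransfer: LANDED — `Summit.QuantumFields.QCD.Cruxes.RobustYangMillsRG.Birth.stub_positiveTransfer`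
-- (`BlockedLawNonneg → PositiveInvariantFormatClustering → GaugeInvariantClustering`, the three rendered by notations for the
-- verbatim terms above; tree `Summits/QuantumFields/QCD/Theorems/NestedDissectionSeaRobustYangMillsRGStubPositiveTransfer.lean`
-- p151123; imported above, sorried copy removed; mechanism: pushforward bookkeeping + a.e.-positivity + the `|F|`-repair).

-- stub_gaugeAveraging: LANDED — `Summit.QuantumFields.QCD.Cruxes.RobustYangMillsRG.Birth.stub_gaugeAveraging`
-- (tree `Summits/QuantumFields/QCD/Theorems/NestedDissectionSeaRobustYangMillsRGStubGaugeAveraging.lean`, imported above; the sorried copy is removed so the names do not clash).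

/-! ### The composition -/

/-- **Composition** (kernel-checked, sorry-free closure): the three named stub statements imply the crux
BY NAME — `β₀ := max β₁ (max β₂ β₃)`, then modus ponens inside the shared admissible context. [folklore] -/
theorem RobustYangMillsRG_of (h₁ : Statement.stub_slabStateBound)
    (h₂ : Statement.stub_gaugeInvariantClustering) (h₃ : Statement.stub_gaugeAveraging) :
    Summit.QuantumFields.QCD.Theses.NestedDissectionSea.RobustYangMillsRG := by
  -- `intro` unfolds the crux constant by `whnf`, which also instantiates its two leading `let`s
  -- (`G`, `ρ`); applying a named stub statement unfolds it and instantiates its `let`s the same way.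
  intro ε r B₀ κ c₀ cA A₀ hε hr hB₀ hκ hc₀ hcA hA₀
  obtain ⟨β₁, hβ₁, H₁⟩ := h₁ ε r B₀ κ c₀ cA A₀ hε hr hB₀ hκ hc₀ hcA hA₀
  obtain ⟨β₂, hβ₂, H₂⟩ := h₂ ε r B₀ κ c₀ cA A₀ hε hr hB₀ hκ hc₀ hcA hA₀
  obtain ⟨β₃, hβ₃, H₃⟩ := h₃ ε r B₀ κ c₀ cA A₀ hε hr hB₀ hκ hc₀ hcA hA₀
  refine ⟨max β₁ (max β₂ β₃), lt_max_of_lt_left hβ₁, ?_⟩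
  intro a L ha ha0 haL ℓ₀ hℓ₀ b N M cor μ LF AdmAt w βe Bl hβe hadm
  have hadm₁ : ∀ᶠ k in atTop, β₁ ≤ βe k ∧ ∀ S, L k ≤ S → AdmAt w βe Bl k S :=
    hadm.mono fun k hk => ⟨(le_max_left _ _).trans hk.1, hk.2⟩
  have hadm₂ : ∀ᶠ k in atTop, β₂ ≤ βe k ∧ ∀ S, L k ≤ S → AdmAt w βe Bl k S :=
    hadm.mono fun k hk => ⟨((le_max_left _ _).trans (le_max_right _ _)).trans hk.1, hk.2⟩
  have hadm₃ : ∀ᶠ k in atTop, β₃ ≤ βe k ∧ ∀ S, L k ≤ S → AdmAt w βe Bl k S :=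
    hadm.mono fun k hk => ⟨((le_max_right _ _).trans (le_max_right _ _)).trans hk.1, hk.2⟩
  exact H₃ a L ha ha0 haL ℓ₀ hℓ₀ w βe Bl hβe hadm₃ (H₁ a L ha ha0 haL ℓ₀ hℓ₀ w βe Bl hβe hadm₁)
    (H₂ a L ha ha0 haL ℓ₀ hℓ₀ w βe Bl hβe hadm₂)

/-- The registrar's composition in its original shape (Stubs 1 and 2 as hypotheses, Stub 3 landed). [folklore] -/
theorem RobustYangMillsRG_skeleton_v1 (h₁ : Statement.stub_slabStateBound)
    (h₂ : Statement.stub_gaugeInvariantClustering) :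
    Summit.QuantumFields.QCD.Theses.NestedDissectionSea.RobustYangMillsRG :=
  RobustYangMillsRG_of h₁ h₂ stub_gaugeAveraging

/-- **Composition after the wave-2 reshape** (kernel-checked, sorry-free closure): the positivity of
the blocked law, the context-free positive core and the positive transfer imply the crux BY NAME —
Stub 1 from positivity (`slabStateBound_of_blockedLawNonneg`), Stub 2 by the transfer, Stub 3 landed
(`stub_gaugeAveraging`, tree). [folklore] -/
theorem RobustYangMillsRG_of' (h₁ : BlockedLawNonneg) (h₂ : PositiveInvariantFormatClustering)
    (h₃ : BlockedLawNonneg → PositiveInvariantFormatClustering → GaugeInvariantClustering) :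
    Summit.QuantumFields.QCD.Theses.NestedDissectionSea.RobustYangMillsRG :=
  RobustYangMillsRG_of (slabStateBound_of_blockedLawNonneg h₁) (h₃ h₁ h₂) stub_gaugeAveraging

/-- **The skeleton closed over its stubs** (depends on `sorryAx` exactly through the two named
conditions `stub_blockedLawNonneg` (realisability ⇒ positivity) and
`stub_positiveInvariantFormatClustering` (the Yang–Mills-grade positive core); `stub_positiveTransfer`
and `stub_gaugeAveraging` are tree theorems). [folklore] -/
theorem RobustYangMillsRG_skeleton :
    Summit.QuantumFields.QCD.Theses.NestedDissectionSea.RobustYangMillsRG :=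
  RobustYangMillsRG_of' stub_blockedLawNonneg stub_positiveInvariantFormatClustering stub_positiveTransfer


/-! ### §N  The realisability-free sub-cut of the core (idea `af-funnel`, file `Sketch_r1_k2`) and its fate

The lead's analysis (PICKED.md): the ideator's transfer target `FormatBallClustering` — uniform slab
clustering for EVERY normalised SIGNED coercive-format density, no fine lattice, no `w`, no `Bl` — is
FALSE AS TYPED: with `W = 0`, `A = cA • wilson` and a sign functional `F(Z, V) = ∏_{y ∈ Z ∩ T} φ(V (y,1))`
on a sparse set `T` of slab sites (direction-1 links pairwise vertex-disjoint), the `t = 0` instance of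
the conclusion fails for every `C` once the volume is large (tail-site gauge averaging makes the links
`V (y,1)`, `y ∈ T`, i.i.d. Haar given the invariant σ-algebra, so `∫ dens = Z · E[m₁^X] > 0` while the
normalised second moment grows like `(1 + (m₂/m₁ - 1) δ)^{2|T|}` by a finite-energy lower bound).
Consequently the sub-cut can only be re-typed for POSITIVE densities, and then it no longer transfers
to the crux without a realisability statement (`stub_slabStateBound` / non-negativity of the blocked
law) — which is exactly Stub 1. The three stubs below are the helper statements of that negative
certificate (`stub_formatBallClustering_false`, assembled by the lead from the two context-free
lemmas); they are NOT hypotheses of `RobustYangMillsRG_of`. -/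

/-- Verbatim copy of `Summit.QuantumFields.QCD.Cruxes.RobustYangMillsRG.Ideator2.FormatBallClustering`
(crux workfile `Sketch_r1_k2.lean`, not importable here): the realisability-free transfer target C⁺ of
idea `af-funnel`. [folklore] -/
def FormatBallClustering : Prop :=
  let G := ↥(Matrix.specialUnitaryGroup (Fin 3) ℂ)
  let ρ : G →* Matrix (Fin 3) (Fin 3) ℂ := fundamentalRep (Fin 3)
  ∀ ε r B₀ κ c₀ cA A₀ : ℝ, 0 < ε → 0 < r → 0 < B₀ → 0 < κ → 0 < c₀ → 0 < cA → 0 < A₀ →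
  ∃ β₀ : ℝ, 0 < β₀ ∧ ∀ β₁ : ℝ, β₀ ≤ β₁ →
  ∃ Δ : ℝ, 0 < Δ ∧ ∀ h : ℕ, ∃ C : ℝ, ∀ (M : ℕ) [NeZero M],
  let μ : Measure (GaugeConfig 4 M G) := Measure.pi fun _ => haarProbability G
  let LF : GaugeConfig 4 M G → Finset (Site 4 M) := fun V =>
    Finset.univ.filter fun y => ∃ i j : Fin 4, ε < 3 - (ρ (plaquetteHolonomy V y i j)).trace.re
  ∀ (βe : ℝ) (A W : QuasiLocalGaugePerturbation 4 M G 1)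
    (F : Finset (Site 4 M) → GaugeConfig 4 M G → ℝ),
  β₀ ≤ βe → βe ≤ β₁ →
  A.HasAnalyticNormLE ρ (smallFieldDomain ρ 1 r ε) κ A₀ → A.NormLE κ A₀ →
  (∀ X ∈ polymers 1, (∃ V, A.act X V ≠ 0) →
    ∀ y ∈ X, ∀ y' ∈ X, ∀ i, (y i - y' i).val ≤ X.card ∨ (y' i - y i).val ≤ X.card) →
  (∀ V, cA * wilsonAction ρ V ≤ A.total V - A.total fun _ => 1) →
  W.HasAnalyticNormLE ρ (smallFieldDomain ρ 1 r ε) κ B₀ → W.NormLE κ B₀ →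
  (∀ X ∈ polymers 1, (∃ V, W.act X V ≠ 0) →
    ∀ y ∈ X, ∀ y' ∈ X, ∀ i, (y i - y' i).val ≤ X.card ∨ (y' i - y i).val ≤ X.card) →
  (∀ Z, Measurable (F Z)) → (∀ V, F ∅ V = 1) → (∀ Z V, |F Z V| ≤ Real.exp (c₀ * Z.card)) →
  (∀ Z (n : ℕ) V V', (∀ e, (∃ y ∈ Z, ∀ i, (e.1 i - y i).val ≤ n ∨ (y i - e.1 i).val ≤ n) →
      V e = V' e) → |F Z V - F Z V'| ≤ Real.exp (c₀ * Z.card + κ * (4 - n))) →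
  (∀ Z₁ Z₂ (n : ℕ), (∀ y ∈ Z₁, ∀ y' ∈ Z₂, ∃ i, n < (y i - y' i).val ∧ n < (y' i - y i).val) →
      ∀ V, |F (Z₁ ∪ Z₂) V - F Z₁ V * F Z₂ V| ≤ Real.exp (c₀ * (Z₁.card + Z₂.card) + κ * (4 - n))) →
  let dens : GaugeConfig 4 M G → ℝ := fun V =>
    Real.exp (-(βe * A.total V) - W.total V) * F (LF V) V
  let E : (GaugeConfig 4 M G → ℝ) → ℝ := fun G₀ => (∫ V, G₀ V * dens V ∂μ) / ∫ V, dens V ∂μ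
  (0 < ∫ V, dens V ∂μ) →
  ∀ (t : ℕ) (G₁ G₂ : GaugeConfig 4 M G → ℝ) (C₁ C₂ : ℝ), 2 * t ≤ M →
  Measurable G₁ → Measurable G₂ → (∀ V, |G₁ V| ≤ C₁) → (∀ V, |G₂ V| ≤ C₂) →
  DependsOn G₁ {e | (e.1 0).val < h} → DependsOn G₂ {e | (e.1 0).val < h} →
  |E (fun V => G₁ V * G₂ (torusConfigShift (Pi.single 0 (t : ZMod M)) V))
    - E G₁ * E (fun V => G₂ (torusConfigShift (Pi.single 0 (t : ZMod M)) V))|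
    ≤ C * C₁ * C₂ * Real.exp (-(Δ * t))

-- stub_wilsonAnalyticNorm: LANDED — `Summit.QuantumFields.QCD.Cruxes.RobustYangMillsRG.Birth.stub_wilsonAnalyticNorm`
-- (tree `Summits/QuantumFields/QCD/Theorems/NestedDissectionSeaRobustYangMillsRGStubWilsonAnalyticNorm.lean`, imported above; the sorried copy is removed so the names do not clash).

-- stub_su3SignSet: LANDED — `Summit.QuantumFields.QCD.Cruxes.RobustYangMillsRG.Birth.stub_su3SignSet`
-- (tree `Summits/QuantumFields/QCD/Theorems/NestedDissectionSeaRobustYangMillsRGStubSU3SignSet.lean`, imported above; the sorried copy is removed so the names do not clash).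

-- stub_formatBallClustering_false: LANDED — `Summit.QuantumFields.QCD.Cruxes.RobustYangMillsRG.Birth.stub_formatBallClustering_false`
-- (tree `Summits/QuantumFields/QCD/Theorems/NestedDissectionSeaRobustYangMillsRGStubFormatBallClusteringFalse.lean` p149100, with support
-- files `…Aux.lean` p146753, `…Aux2.lean` p147347, `…Aux3.lean` p146756, `…Aux4.lean` p146759; imported above, sorried copy removed).

/-- **The af-funnel transfer target is false, by name** (`¬ FormatBallClustering` for the `def` above;
the landed `stub_formatBallClustering_false` (p149100) states the same term through a notation, so this
is a definitional re-typing). Consequence for the line: the realisability-free sub-cut of the core can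
only be re-typed for POSITIVE densities (`PositiveInvariantFormatClustering`), and then its transfer to
the crux needs the positivity of the blocked law (`BlockedLawNonneg`) — done in `stub_positiveTransfer`. [folklore] -/
theorem formatBallClustering_false : ¬ FormatBallClustering :=
  stub_formatBallClustering_false

end Summit.QuantumFields.QCD.Cruxes.RobustYangMillsRG.Birth
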